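import Literature.MathematicalPhysics.QuantumFieldTheory.Balaban1983to89.B6ZoneByPartsV1L0
import Literature.MathematicalPhysics.QuantumFieldTheory.Balaban1983to89.B6Cover236MultiLevelTorusReachL0
import Literature.MathematicalPhysics.QuantumFieldTheory.Balaban1983to89.B4PartitionUnity22
import HarnessLib
import Literature.MathematicalPhysics.QuantumFieldTheory.Balaban1983to89.B6Geom246MultiLevelBoxL0
import Literature.MathematicalPhysics.QuantumFieldTheory.Balaban1983to89.B6GlobalChartV1L0
import Literature.MathematicalPhysics.QuantumFieldTheory.Balaban1983to89.B6MultiLevelTorusOperatorL0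
import Literature.MathematicalPhysics.QuantumFieldTheory.Balaban1983to89.B6ScalarFactorsChartV1L0
import Literature.MathematicalPhysics.QuantumFieldTheory.Balaban1983to89.B8Ineq192MultiLevelTorusL0
import Literature.MathematicalPhysics.QuantumFieldTheory.Balaban1983to89.B6Line3CutoffV1

/-!
# `Balaban1983to89.B6Line3CutoffV1L0` — LEVEL-0 TWIN (programme G-F3′-L0, director-ym LINE №27 / UV3-NODE §24.5; plan `lit-balaban-r03/G-F3L0-PLAN.md`) of `B6Line3CutoffV1`:
the same declarations, SAME NAMES AND STATEMENTS, for nested families WITH print's region `Λ₀ = T ∖ Ω₁` ADMITTED (structures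
`B6MultiLevelBoxOperatorL0.Domains` / `B6MultiLevelTorusOperatorL0.TDomains`: levels `0, …, k`, the level-`0` block a single site, `Q′₀ = id`,
finite weight `a₀` — print p.225 (2.14) «Σ_{j=0}^k … (Q′₀λ)(x) = λ(x), x ∈ Λ₀», p.229 «taking a sequence (2.1) … smallest possible domains B^j(Λ_j),
and considering the operator Δ_a defined by (2.19), (2.20) for this sequence»).  Every `D`-free object is the lineage's, consumed BY NAME; no existing
module is touched; no fact is minted.  Unit `lit-balaban-p21` (packet S-B owner, S-C tail; p21 gen 27; port tooling by r03 gen 36 / p33 gen 88); B6 fold owner r03; referee ref-4.  THE TWIN'S DOCUMENTATION FOLLOWS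
VERBATIM (its «levels 1 … k» / «Ω₁ = X» sentences describe the twin; here `j` runs from `0` and `Ω₁` may be a proper subset).

# `Balaban1983to89.B6Line3CutoffV1` — T. Bałaban, *Propagators and renormalization transformations for lattice gauge theories. II*,
# Commun. Math. Phys. **96** (1984) 223–250 [Balaban1984PropagatorsII], p. 238–239: THE SITE CUT-OFF `χ_□` OF THE DOMAIN CHANGE IN LINE 3 OF (2.92)
# — a product of one-dimensional `C^∞` plateaus on the fine lattice of the V1 torus, its zone of variation, its sizes, and the column cut `c_L`

statement-level skeleton of published theorems with citation tags; proofs where landed; nothing here is a claim about the Yang–Mills mass gap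

PDF held: `paper:balaban1984-cmp96-propagators-rt-ii` (journal page = PDF page + 222): p. 238 [PDF 16] (*"An estimate of the terms with the commutator is
even simpler and gives a factor O(M⁻¹)"*, the cubes `□ ⊂ □̃ ⊂ □̃² ⊂ □̃³`), p. 239 [PDF 17] ((2.92) line 3 `ζ_□(∂P∂* − ∂P_□∂*)h_□`), p. 229 [PDF 7]
((2.36): *"h_□ ∈ C₀^∞(□̃)"*); [Balaban1983RegularityDecay] §2 p. 577 (*"|∂^ηh_j| ≤ O(M⁻¹), |Δ^ηh_j| ≤ O(M⁻²)"*) for the sizes of product cut-offs.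

CITATION HEADER (lean-in-tree rule) — WHAT IS REPRODUCED.  Phase-2 file of the `lit-balaban` typed skeleton (HOME `run/shared/lean/pub/lit-balaban/`),
unit `lit-balaban-r03` (B6 fold owner; r03 gen 22, literature-prover-lit-balaban-r03-g22-0), referee ref-4.  SKELETON rows **B6.Prop2.6** ×
**B6.Eq2.92** × B6.Eq2.36 (cells; decls of record untouched).  This is input (d) of B6-CLOSURE §5 item 16 (the cube bookkeeping of p22's
`…B6Line3WindowV1L0.line3_window`: its binders `χ`, `N`, `s₁, s₂, s_b`, `c_L` and the twelve hypotheses `hχ0 … hcL`, `hEL`).  IMPORTS BY NAME, restating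
nothing: `…B4PartitionUnity22` (r01: `thetaProf`, `thetaCube`, `D1`, `D2`, `abs_thetaCube_diff_le`, `abs_thetaCube_second_diff_le`, `abs_sub_le_D1`),
`…B6AgreeLapV1Chart` (r03 g19: `DeepS`, `shift_mem_deepS`, `unshift_mem_deepS`), `…B6ScalarFactorsChartV1` (p22: `blkS`), `…B6ZoneByPartsV1` (p22:
`shInv`), `…B6Cover236MultiLevelTorusReach` (p21: `abs_sub_le_of_blkOf_eq`).

## WHAT THIS FILE CERTIFIES (kernel-checked, 0 sorry, standard axioms; two `def`s `chiR`/`chiS` (the cut-off), `zoneN` (its zone), `cL` (the column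
cut) with their API — no `def … : Prop`, no new named fact)

* §1 `chiR ctr M_c p = Π_μ θ((p_μ − ctr_μ)/M_c)` on `ℝ^{d+1}` (r01's `thetaCube` recentred): `0 ≤ χ ≤ 1`, `χ = 1` on the plateau `|p − ctr|_∞ ≤ ¾M_c`,
  `χ = 0` off `|p − ctr|_∞ < ⅞M_c`, axis first/second differences `≤ D₁|η|/M_c`, `≤ D₂η²/M_c²`, the sup-norm Lipschitz bound `(d+1)D₁/M_c`.
* §2 `chiS ctr M_c x` on the V1 sites (labels `val x_μ`): the support is INSIDE the window with margin `3` (`chiS_deep`), so every lattice step touching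
  the support is a genuine label step (no wrap of the global torus): `hχ3`, `hχjump`, and the sizes `hd1`, `hd1'`, `hd2`, `hdb` of `line3_window` with
  the CONSTANTS `s₁ = D₁(θ)`, `s₂ = D₂(θ)`, `s_b = (d+1)D₁(θ)` as soon as the blocks near the support have side `≤ M_c` (`hwin`).
* §3 the zone `zoneN` := blocks containing a site at which `χ` or a neighbouring value of `χ` differs from `1`: `hχN`, `hNχ`, non-emptiness.
* §4 the column cut `cL` := indicator of the plateau: `hcL`, and `hEL` (`ζ∂(c_L·) = ζ∂` for every bond cut-off `ζ` whose bonds have both ends on the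
  plateau).

## HONEST SCOPE / DIVERGENCES

(1) Print does not spell the cut-off of the domain change out (p. 238 *"even simpler"*); the product-of-plateaus shape is [Balaban1983RegularityDecay]
§2's `h_j`, the sizes are r01's generic `abs_prod_diff_le`/`abs_prod_second_diff_le`.  (2) Everything is relative to a window `(t, x₀)` of
`…B6AgreeLapV1Chart` and a centre/scale `(ctr, M_c)` with `x₀_μ + ⅞M_c + 3 ≤ ctr_μ`, `ctr_μ + ⅞M_c + 3 ≤ x₀_μ + N′` — instantiated per cube by the
line-3 closer (`ctr` = chart centre of the central cube, `M_c = 8S/3`).  (3) Integer torus, lattice units; no measure; NOT summit progress.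
-/

open scoped BigOperators
open Finset

namespace Literature.MathematicalPhysics.QuantumFieldTheory.Balaban1983to89.B6Line3CutoffV1L0

open B4Reflection242 (boxDom)
open B4PartitionUnity22 (thetaProf thetaCube D1 D2 thetaCube_mem_Icc thetaCube_eq_one thetaCube_eq_zero abs_thetaCube_diff_le
  abs_thetaCube_second_diff_le abs_sub_le_D1 contDiff_thetaProf hasCompactSupport_thetaProf thetaProf_nonneg thetaProf_le_one D1_nonneg D2_nonneg)
open B6MultiLevelBoxOperator (N0)
open B6MultiLevelTorusOperatorL0 (TDomains)
open B6Geom246MultiLevelBox (toR)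
open B6Geom246MultiLevelBoxL0 (bset blkOf)
open B8Ineq192MultiLevelTorusL0 (geomTB geomTB_len)
open B6Ineq2133TwoScaleV1 (onFun onFun_apply)
open B6SectAOperatorsV1 (dE)
open B6Prop26Gluing (mulOp mulOp_apply)
open B6GlobalChartV1 (PV toBox toBox_apply)
open B6GlobalChartV1L0 (blkV1)
open B6ScalarFactorsChartV1L0 (blkS blkV1_eq_blkS)
open B6AgreeLapV1Chart (DeepS deepS_mono shift_mem_deepS unshift_mem_deepS)
open B6Prop25TwoScaleCensus (TSIdx)
open B6ZoneByPartsV1 (shInv shInv_tt shInv_ff)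
open B6Cover236MultiLevelTorusReachL0 (abs_sub_le_of_blkOf_eq)
open Literature.MathematicalPhysics.QuantumFieldTheory.Balaban1983to89.B6Line3CutoffV1 (chiR chiR_eq chiR_nonneg chiR_le_one abs_chiR_le_one chiR_eq_one chiR_eq_zero near_of_chiR_ne_zero far_of_chiR_ne_one abs_chiR_axis_diff_le abs_chiR_axis_second_diff_le abs_chiR_sub_le lab lab_apply lab_eq_toR chiS chiS_nonneg chiS_le_one chiS_eq_one lab_shift lab_unshift NearS nearS_mono near_of_chiS_ne_zero chiS_eq_zero_of_not_near deep_of_near shift_near unshift_near chiS_shift_eq_zero_of_not_near chiS_deep chiS_jump D1_thetaProf_nonneg D2_thetaProf_nonneg cL cL_eq_one cL_mul_chiS hEL_cL chiS_ne_one_of_corner)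

noncomputable section

variable {d : ℕ}

/-! ## §1  The product cut-off on `ℝ^{d+1}` -/

section Real

variable (ctr : Fin (d + 1) → ℝ) {Mc : ℝ}

/-- recentring commutes with a move along an axis. [folklore] -/
private theorem update_sub_ctr (p : Fin (d + 1) → ℝ) (μ : Fin (d + 1)) (v : ℝ) :
    (fun ν => Function.update p μ v ν - ctr ν) = Function.update (fun ν => p ν - ctr ν) μ (v - ctr μ) := by
  funext ν
  by_cases h : ν = μ
  · subst h; simp
  · simp [Function.update_of_ne h]

/-- products of `[0, 1]`-valued factors: `|Πa − Πb| ≤ Σ|a − b|`. [folklore] -/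
private theorem abs_prod_sub_prod_le_sum {ι : Type*} (s : Finset ι) {a b : ι → ℝ}
    (ha0 : ∀ i ∈ s, 0 ≤ a i) (ha1 : ∀ i ∈ s, a i ≤ 1) (hb0 : ∀ i ∈ s, 0 ≤ b i) (hb1 : ∀ i ∈ s, b i ≤ 1) :
    |∏ i ∈ s, a i - ∏ i ∈ s, b i| ≤ ∑ i ∈ s, |a i - b i| := by
  classical
  induction s using Finset.induction_on with
  | empty => simp
  | insert j s hj ih =>
    have ih' := ih (fun i hi => ha0 i (Finset.mem_insert_of_mem hi)) (fun i hi => ha1 i (Finset.mem_insert_of_mem hi))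
      (fun i hi => hb0 i (Finset.mem_insert_of_mem hi)) (fun i hi => hb1 i (Finset.mem_insert_of_mem hi))
    have haj0 := ha0 j (Finset.mem_insert_self _ _)
    have haj1 := ha1 j (Finset.mem_insert_self _ _)
    have hB0 : 0 ≤ ∏ i ∈ s, b i := Finset.prod_nonneg fun i hi => hb0 i (Finset.mem_insert_of_mem hi)
    have hB1 : ∏ i ∈ s, b i ≤ 1 :=
      Finset.prod_le_one (fun i hi => hb0 i (Finset.mem_insert_of_mem hi)) fun i hi => hb1 i (Finset.mem_insert_of_mem hi)
    rw [Finset.prod_insert hj, Finset.prod_insert hj, Finset.sum_insert hj]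
    have e : a j * ∏ i ∈ s, a i - b j * ∏ i ∈ s, b i =
        a j * (∏ i ∈ s, a i - ∏ i ∈ s, b i) + (a j - b j) * ∏ i ∈ s, b i := by ring
    rw [e]
    calc |a j * (∏ i ∈ s, a i - ∏ i ∈ s, b i) + (a j - b j) * ∏ i ∈ s, b i|
        ≤ |a j * (∏ i ∈ s, a i - ∏ i ∈ s, b i)| + |(a j - b j) * ∏ i ∈ s, b i| := abs_add_le _ _
      _ = a j * |∏ i ∈ s, a i - ∏ i ∈ s, b i| + |a j - b j| * ∏ i ∈ s, b i := by
          rw [abs_mul, abs_mul, abs_of_nonneg haj0, abs_of_nonneg hB0]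
      _ ≤ 1 * |∏ i ∈ s, a i - ∏ i ∈ s, b i| + |a j - b j| * 1 := by
          have := abs_nonneg (∏ i ∈ s, a i - ∏ i ∈ s, b i)
          have := abs_nonneg (a j - b j)
          nlinarith
      _ ≤ |a j - b j| + ∑ i ∈ s, |a i - b i| := by linarith

end Real

/-! ## §2  The cut-off on the sites of the V1 torus: labels, genuine lattice steps near the support, the sizes -/

section Sites

variable {ℓ : ℕ} {hd : 1 ≤ d + 1} {hL : Odd (ℓ + 1) ∧ 1 < ℓ + 1} {m K : ℕ}

variable (ctr : Fin (d + 1) → ℝ) {Mc : ℝ}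

/-- `(x + e_μ)_μ = x_μ + 1`. [folklore] -/
private theorem shift_apply_self' {P : Params} {j : ℕ} (x : Site P j) (μ : Fin P.d) : x.shift μ μ = x μ + 1 := by
  simp [Site.shift]

/-- `(x + e_μ)_ν = x_ν`, `ν ≠ μ`. [folklore] -/
private theorem shift_apply_ne' {P : Params} {j : ℕ} (x : Site P j) {μ ν : Fin P.d} (h : ν ≠ μ) : x.shift μ ν = x ν := by
  simp [Site.shift, Function.update_of_ne h]

/-- `(x − e_μ)_μ = x_μ − 1`. [folklore] -/
private theorem unshift_apply_self' {P : Params} {j : ℕ} (x : Site P j) (μ : Fin P.d) : x.unshift μ μ = x μ - 1 := by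
  simp [Site.unshift]

/-- `(x − e_μ)_ν = x_ν`, `ν ≠ μ`. [folklore] -/
private theorem unshift_apply_ne' {P : Params} {j : ℕ} (x : Site P j) {μ ν : Fin P.d} (h : ν ≠ μ) : x.unshift μ ν = x ν := by
  simp [Site.unshift, Function.update_of_ne h]

/-- `(x + e_μ) − e_μ = x`. [folklore] -/
private theorem unshift_shift' {P : Params} {j : ℕ} (x : Site P j) (μ : Fin P.d) : (x.shift μ).unshift μ = x := by
  funext ν
  by_cases h : ν = μ
  · subst h; rw [unshift_apply_self', shift_apply_self']; ring
  · rw [unshift_apply_ne' _ h, shift_apply_ne' _ h]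

/-- `(x − e_μ) + e_μ = x`. [folklore] -/
private theorem shift_unshift' {P : Params} {j : ℕ} (x : Site P j) (μ : Fin P.d) : (x.unshift μ).shift μ = x := by
  funext ν
  by_cases h : ν = μ
  · subst h; rw [shift_apply_self', unshift_apply_self']; ring
  · rw [shift_apply_ne' _ h, unshift_apply_ne' _ h]

open B6Prop25TwoScaleCensus (TSIdx)

variable {a₀ a₁ : ℝ} {t : TSIdx d (ℓ + 1) hd hL a₀ a₁} {x₀ : Fin (d + 1) → ℤ}
variable (hx₀ : ∀ μ, 0 ≤ x₀ μ) (hfit : ∀ μ, x₀ μ + (t.P.sitesPerDir 0 : ℕ) ≤ ((PV d ℓ m K hd hL).sitesPerDir 0 : ℕ))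
variable (hlo : ∀ μ, (x₀ μ : ℝ) + (7 / 8 * Mc + 3) ≤ ctr μ) (hhi : ∀ μ, ctr μ + (7 / 8 * Mc + 3) ≤ (x₀ μ : ℝ) + (t.P.sitesPerDir 0 : ℕ))

variable {Mh k R : ℕ} {P' : Fin (d + 1) → ℕ}
variable (hN : ∀ μ, N0 ℓ Mh k P' μ = (PV d ℓ m K hd hL).sitesPerDir 0) (D : TDomains d ℓ Mh k P' R)
variable (hwin : ∀ x : Site (PV d ℓ m K hd hL) 0, NearS ctr Mc 3 x → (geomTB D).len (blkS hN D x) ≤ Mc)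

omit hwin in
/-- block lengths are nonnegative. [cite: Balaban1984PropagatorsII, (2.1) p.224, dictionary] -/
theorem len_blkS_nonneg (x : Site (PV d ℓ m K hd hL) 0) : 0 ≤ (B8Ineq192MultiLevelTorusL0.geomTB D).len (blkS hN D x) := by
  rw [geomTB_len]; positivity

include hx₀ hfit hlo hhi hwin in
/-- **`hd1`**: `|χ(b₊) − χ(b₋)|·len(y(b)) ≤ D₁(θ)` for every bond `b`. [cite: Balaban1983RegularityDecay, §2 p.577 («|∂^ηh_j| ≤ O(M⁻¹)»); Balaban1984PropagatorsII, p.238] -/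
theorem hd1_chiS (hMc : 0 < Mc) (b : PBond (PV d ℓ m K hd hL) 0) :
    |chiS ctr Mc b.tgt - chiS ctr Mc b.src| * (B8Ineq192MultiLevelTorusL0.geomTB D).len (blkV1 hN D b) ≤ D1 thetaProf := by
  rw [blkV1_eq_blkS]
  by_cases hn : NearS ctr Mc 1 b.src
  · obtain ⟨-, hlab⟩ := shift_near ctr hfit hlo hhi (r := 1) (by norm_num) hn b.dir
    have hdiff : |chiS ctr Mc b.tgt - chiS ctr Mc b.src| ≤ D1 thetaProf * |(1 : ℝ)| / Mc := by
      show |chiR ctr Mc (lab (b.src.shift b.dir)) - chiR ctr Mc (lab b.src)| ≤ _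
      rw [hlab]
      exact abs_chiR_axis_diff_le ctr hMc (lab b.src) b.dir 1
    rw [abs_one, mul_one] at hdiff
    have hlen := hwin b.src (nearS_mono ctr (by norm_num) hn)
    calc |chiS ctr Mc b.tgt - chiS ctr Mc b.src| * (geomTB D).len (blkS hN D b.src)
        ≤ D1 thetaProf / Mc * Mc := mul_le_mul hdiff hlen (len_blkS_nonneg hN D _) (div_nonneg D1_thetaProf_nonneg hMc.le)
      _ = D1 thetaProf := by field_simp
  · rw [chiS_eq_zero_of_not_near ctr hMc hn, show b.tgt = b.src.shift b.dir from rfl,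
      (chiS_shift_eq_zero_of_not_near ctr hx₀ hfit hlo hhi hMc hn b.dir).1, sub_zero, abs_zero, zero_mul]
    exact D1_thetaProf_nonneg

include hx₀ hfit hlo hhi hwin in
/-- **`hd1'`**: `|χ(x) − χ(x ∓ e_μ)|·len(y(x)) ≤ D₁(θ)` (p22's `shInv`). [cite: Balaban1983RegularityDecay, §2 p.577; Balaban1984PropagatorsII, p.238] -/
theorem hd1'_chiS (hMc : 0 < Mc) (e : Fin (d + 1) × Bool) (x : Site (PV d ℓ m K hd hL) 0) :
    |chiS ctr Mc x - chiS ctr Mc (shInv e x)| * (B8Ineq192MultiLevelTorusL0.geomTB D).len (blkS hN D x) ≤ D1 thetaProf := by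
  obtain ⟨μ, bb⟩ := e
  by_cases hn : NearS ctr Mc 1 x
  · have hlen := hwin x (nearS_mono ctr (by norm_num) hn)
    have hdiff : |chiS ctr Mc x - chiS ctr Mc (shInv (μ, bb) x)| ≤ D1 thetaProf / Mc := by
      cases bb
      · rw [shInv_ff, abs_sub_comm]
        obtain ⟨-, hlab⟩ := shift_near ctr hfit hlo hhi (r := 1) (by norm_num) hn μ
        show |chiR ctr Mc (lab (x.shift μ)) - chiR ctr Mc (lab x)| ≤ _
        rw [hlab]
        have h := abs_chiR_axis_diff_le ctr hMc (lab x) μ 1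
        rwa [abs_one, mul_one] at h
      · rw [shInv_tt, abs_sub_comm]
        obtain ⟨-, hlab⟩ := unshift_near ctr hx₀ hlo hhi (r := 1) (by norm_num) hn μ
        show |chiR ctr Mc (lab (x.unshift μ)) - chiR ctr Mc (lab x)| ≤ _
        rw [hlab, show lab x μ - 1 = lab x μ + (-1) by ring]
        have h := abs_chiR_axis_diff_le ctr hMc (lab x) μ (-1)
        rwa [abs_neg, abs_one, mul_one] at h
    calc |chiS ctr Mc x - chiS ctr Mc (shInv (μ, bb) x)| * (geomTB D).len (blkS hN D x)
        ≤ D1 thetaProf / Mc * Mc := mul_le_mul hdiff hlen (len_blkS_nonneg hN D _) (div_nonneg D1_thetaProf_nonneg hMc.le)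
      _ = D1 thetaProf := by field_simp
  · have h0 := chiS_shift_eq_zero_of_not_near ctr hx₀ hfit hlo hhi hMc hn μ
    rw [chiS_eq_zero_of_not_near ctr hMc hn]
    cases bb
    · rw [shInv_ff, h0.1, sub_zero, abs_zero, zero_mul]; exact D1_thetaProf_nonneg
    · rw [shInv_tt, h0.2, sub_zero, abs_zero, zero_mul]; exact D1_thetaProf_nonneg

include hx₀ hfit hlo hhi hwin in
/-- **`hd2`**: `|χ(y + e_μ) − 2χ(y) + χ(y − e_μ)|·len(y(y))² ≤ D₂(θ)`. [cite: Balaban1983RegularityDecay, §2 p.577 («|Δ^ηh_j| ≤ O(M⁻²)»); Balaban1984PropagatorsII, p.238] -/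
theorem hd2_chiS (hMc : 0 < Mc) (y : Site (PV d ℓ m K hd hL) 0) (μ : Fin (d + 1)) :
    |chiS ctr Mc (y.shift μ) - 2 * chiS ctr Mc y + chiS ctr Mc (y.unshift μ)| * (B8Ineq192MultiLevelTorusL0.geomTB D).len (blkS hN D y) ^ 2 ≤ D2 thetaProf := by
  by_cases hn : NearS ctr Mc 1 y
  · have hlen := hwin y (nearS_mono ctr (by norm_num) hn)
    obtain ⟨-, hlab1⟩ := shift_near ctr hfit hlo hhi (r := 1) (by norm_num) hn μ
    obtain ⟨-, hlab2⟩ := unshift_near ctr hx₀ hlo hhi (r := 1) (by norm_num) hn μ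
    have hdiff : |chiS ctr Mc (y.shift μ) - 2 * chiS ctr Mc y + chiS ctr Mc (y.unshift μ)| ≤ D2 thetaProf / Mc ^ 2 := by
      show |chiR ctr Mc (lab (y.shift μ)) - 2 * chiR ctr Mc (lab y) + chiR ctr Mc (lab (y.unshift μ))| ≤ _
      rw [hlab1, hlab2]
      have h := abs_chiR_axis_second_diff_le ctr (Mc := Mc) (lab y) μ 1
      rwa [one_pow, mul_one] at h
    have hl0 := len_blkS_nonneg hN D y
    calc |chiS ctr Mc (y.shift μ) - 2 * chiS ctr Mc y + chiS ctr Mc (y.unshift μ)| * (geomTB D).len (blkS hN D y) ^ 2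
        ≤ D2 thetaProf / Mc ^ 2 * Mc ^ 2 :=
          mul_le_mul hdiff (pow_le_pow_left₀ hl0 hlen 2) (by positivity) (div_nonneg D2_thetaProf_nonneg (by positivity))
      _ = D2 thetaProf := by field_simp
  · have h0 := chiS_shift_eq_zero_of_not_near ctr hx₀ hfit hlo hhi hMc hn μ
    rw [chiS_eq_zero_of_not_near ctr hMc hn, h0.1, h0.2]
    norm_num
    exact D2_thetaProf_nonneg

omit hwin in
/-- labels of two sites of one block differ by less than the side. [cite: Balaban1984PropagatorsII, (2.1) p.224, dictionary] -/
theorem dist_lab_le_of_blkS_eq {x y : Site (PV d ℓ m K hd hL) 0} (h : B6ScalarFactorsChartV1L0.blkS hN D x = blkS hN D y) :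
    dist (lab x) (lab y) ≤ (geomTB D).len (blkS hN D x) - 1 := by
  have hL1 : (1 : ℝ) ≤ (geomTB D).len (blkS hN D x) := by
    rw [geomTB_len, mul_one]; exact one_le_pow₀ (by linarith [(Nat.cast_nonneg ℓ : (0 : ℝ) ≤ ℓ)])
  refine (dist_pi_le_iff (by linarith)).2 fun μ => ?_
  rw [Real.dist_eq]
  have key := abs_sub_le_of_blkOf_eq D.toDomains (rfl : blkOf D.toDomains (toBox hN x) = blkS hN D x) h.symm μ
  rw [geomTB_len, mul_one]
  have e1 : lab x μ = ((toBox hN x).1 μ : ℝ) := by simp [toBox_apply]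
  have e2 : lab y μ = ((toBox hN y).1 μ : ℝ) := by simp [toBox_apply]
  rw [e1, e2]
  have e3 : ((((ℓ + 1) ^ (blkS hN D x).1.1 : ℕ) : ℝ)) = ((ℓ : ℝ) + 1) ^ (blkS hN D x).1.1 := by push_cast; ring
  rw [← e3]; exact key

include hwin in
/-- **`hdb`**: the oscillation of `χ` over a block is `≤ (d+1)D₁(θ)`. [cite: Balaban1983RegularityDecay, §2 p.577; Balaban1984PropagatorsII, p.238] -/
theorem hdb_chiS (hMc : 0 < Mc) (x y : Site (PV d ℓ m K hd hL) 0) (h : B6ScalarFactorsChartV1L0.blkS hN D x = blkS hN D y) :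
    |chiS ctr Mc x - chiS ctr Mc y| ≤ ((d : ℝ) + 1) * D1 thetaProf := by
  have hD1 := D1_thetaProf_nonneg
  -- the near case, for either order
  have key : ∀ {x y : Site (PV d ℓ m K hd hL) 0}, blkS hN D x = blkS hN D y → NearS ctr Mc 1 x →
      |chiS ctr Mc x - chiS ctr Mc y| ≤ ((d : ℝ) + 1) * D1 thetaProf := by
    intro x y h hn
    have hlen := hwin x (nearS_mono ctr (by norm_num) hn)
    have hdist : dist (lab x) (lab y) ≤ Mc := by linarith [dist_lab_le_of_blkS_eq hN D h]
    calc |chiS ctr Mc x - chiS ctr Mc y| ≤ ((d : ℝ) + 1) * D1 thetaProf / Mc * dist (lab x) (lab y) := abs_chiR_sub_le ctr hMc _ _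
      _ ≤ ((d : ℝ) + 1) * D1 thetaProf / Mc * Mc := mul_le_mul_of_nonneg_left hdist (by positivity)
      _ = ((d : ℝ) + 1) * D1 thetaProf := by field_simp
  by_cases hx : NearS ctr Mc 1 x
  · exact key h hx
  by_cases hy : NearS ctr Mc 1 y
  · rw [abs_sub_comm]; exact key h.symm hy
  rw [chiS_eq_zero_of_not_near ctr hMc hx, chiS_eq_zero_of_not_near ctr hMc hy, sub_zero, abs_zero]
  positivity

end Sites

/-! ## §3  The zone of a cut-off: the blocks where `χ` or a neighbouring value of `χ` differs from `1` -/

section Zone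

variable {ℓ : ℕ} {hd : 1 ≤ d + 1} {hL : Odd (ℓ + 1) ∧ 1 < ℓ + 1} {m K : ℕ} {Mh k R : ℕ} {P' : Fin (d + 1) → ℕ}
variable (hN : ∀ μ, N0 ℓ Mh k P' μ = (PV d ℓ m K hd hL).sitesPerDir 0) (D : TDomains d ℓ Mh k P' R) (χ : Site (PV d ℓ m K hd hL) 0 → ℝ)

open Classical in
/-- **THE ZONE `N` OF A CUT-OFF `χ`**: the blocks `y ∈ 𝔅` containing a site `x` such that `χ(x) ≠ 1` or `χ(x ± e_μ) ≠ 1` for some `μ` — off `N`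
the cut-off is `1` together with its lattice neighbours (the rows of `[χ, Δ′]` live in `N`). [cite: Balaban1984PropagatorsII, p.238 («the terms with the commutator»), bookkeeping ours] -/
def zoneN : Finset ↥(bset D.toDomains) :=
  Finset.univ.filter fun y => ∃ x : Site (PV d ℓ m K hd hL) 0, blkS hN D x = y ∧ (χ x ≠ 1 ∨ ∃ μ, χ (x.shift μ) ≠ 1 ∨ χ (x.unshift μ) ≠ 1)

open Classical in
/-- membership in the zone. [cite: Balaban1984PropagatorsII, p.238, bookkeeping] -/
theorem mem_zoneN {y : ↥(bset D.toDomains)} :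
    y ∈ zoneN hN D χ ↔ ∃ x : Site (PV d ℓ m K hd hL) 0, blkS hN D x = y ∧ (χ x ≠ 1 ∨ ∃ μ, χ (x.shift μ) ≠ 1 ∨ χ (x.unshift μ) ≠ 1) := by
  unfold zoneN
  rw [Finset.mem_filter]
  exact ⟨fun h => h.2, fun h => ⟨Finset.mem_univ _, h⟩⟩

/-- a block containing a site with `χ ≠ 1` is in the zone. [cite: Balaban1984PropagatorsII, p.238, bookkeeping] -/
theorem blkS_mem_zoneN {x : Site (PV d ℓ m K hd hL) 0} (h : χ x ≠ 1) : blkS hN D x ∈ zoneN hN D χ :=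
  (mem_zoneN hN D χ).2 ⟨x, rfl, Or.inl h⟩

/-- **`hχN`**: off the zone `χ = 1`. [cite: Balaban1984PropagatorsII, p.238, bookkeeping] -/
theorem chi_eq_one_of_not_mem_zoneN (x : Site (PV d ℓ m K hd hL) 0) (h : blkS hN D x ∉ zoneN hN D χ) : χ x = 1 := by
  by_contra hne
  exact h (blkS_mem_zoneN hN D χ hne)

/-- **`hNχ`**: off the zone `χ` is constant under lattice steps and along the block. [cite: Balaban1984PropagatorsII, p.238, bookkeeping] -/
theorem chi_const_of_not_mem_zoneN (y : Site (PV d ℓ m K hd hL) 0) (h : blkS hN D y ∉ zoneN hN D χ) :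
    (∀ μ, χ (y.shift μ) = χ y ∧ χ (y.unshift μ) = χ y) ∧ ∀ x : Site (PV d ℓ m K hd hL) 0, blkS hN D x = blkS hN D y → χ x = χ y := by
  have hy : χ y = 1 := chi_eq_one_of_not_mem_zoneN hN D χ y h
  refine ⟨fun μ => ⟨?_, ?_⟩, fun x hx => ?_⟩
  · by_contra hne
    rw [hy] at hne
    exact h ((mem_zoneN hN D χ).2 ⟨y, rfl, Or.inr ⟨μ, Or.inl hne⟩⟩)
  · by_contra hne
    rw [hy] at hne
    exact h ((mem_zoneN hN D χ).2 ⟨y, rfl, Or.inr ⟨μ, Or.inr hne⟩⟩)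
  · rw [hy]
    by_contra hne
    exact h (hx ▸ blkS_mem_zoneN hN D χ hne)

/-- **`hNne`**: the zone is non-empty as soon as `χ ≠ 1` somewhere. [cite: Balaban1984PropagatorsII, p.238, bookkeeping] -/
theorem zoneN_nonempty {z : Site (PV d ℓ m K hd hL) 0} (h : χ z ≠ 1) : (zoneN hN D χ).Nonempty := ⟨_, blkS_mem_zoneN hN D χ h⟩

end Zone

/-! ## §4  The column cut `c_L` (indicator of the plateau): `hcL` and `hEL` -/

section Column

variable {ℓ : ℕ} {hd : 1 ≤ d + 1} {hL : Odd (ℓ + 1) ∧ 1 < ℓ + 1} {m K : ℕ}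
variable (ctr : Fin (d + 1) → ℝ) (Mc : ℝ)

variable {Mc}

end Column

/-! ## §5  The zone of `χ_□` lies off the shrunken plateau: every zone block contains a site `x` with `|val x_μ − ctr_μ| > ¾M_c − 1` for some `μ` -/

section ZoneFar

variable {ℓ : ℕ} {hd : 1 ≤ d + 1} {hL : Odd (ℓ + 1) ∧ 1 < ℓ + 1} {m K : ℕ} {Mh k R : ℕ} {P' : Fin (d + 1) → ℕ}
variable (hN : ∀ μ, N0 ℓ Mh k P' μ = (PV d ℓ m K hd hL).sitesPerDir 0) (D : TDomains d ℓ Mh k P' R)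
variable (ctr : Fin (d + 1) → ℝ) {Mc : ℝ}
variable {a₀ a₁ : ℝ} {t : TSIdx d (ℓ + 1) hd hL a₀ a₁} {x₀ : Fin (d + 1) → ℤ}
variable (hx₀ : ∀ μ, 0 ≤ x₀ μ) (hfit : ∀ μ, x₀ μ + (t.P.sitesPerDir 0 : ℕ) ≤ ((PV d ℓ m K hd hL).sitesPerDir 0 : ℕ))
variable (hlo : ∀ μ, (x₀ μ : ℝ) + (7 / 8 * Mc + 3) ≤ ctr μ) (hhi : ∀ μ, ctr μ + (7 / 8 * Mc + 3) ≤ (x₀ μ : ℝ) + (t.P.sitesPerDir 0 : ℕ))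

include hx₀ hfit hlo hhi in
/-- **THE ZONE OF `χ_□` IS FAR FROM THE CENTRE**: a block of `zoneN (χ_□)` contains a site with a label coordinate farther than `¾M_c − 1` from the
centre (a site of the shrunken plateau has `χ = 1` at itself and at all its lattice neighbours). [cite: Balaban1984PropagatorsII, p.238; bookkeeping ours] -/
theorem exists_far_of_mem_zoneN (hMc : 0 < Mc) {y : ↥(bset D.toDomains)} (hy : y ∈ zoneN hN D (chiS ctr Mc)) :
    ∃ x : Site (PV d ℓ m K hd hL) 0, blkS hN D x = y ∧ ∃ μ, 3 / 4 * Mc - 1 < |lab x μ - ctr μ| := by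
  obtain ⟨x, hxy, hcase⟩ := (mem_zoneN hN D (chiS ctr Mc)).1 hy
  refine ⟨x, hxy, ?_⟩
  by_contra hall
  push Not at hall
  have hn : NearS ctr Mc (-(Mc / 8) - 1 / 2) x := fun μ => by have := hall μ; linarith
  have hr : -(Mc / 8) - 1 / 2 ≤ 2 := by linarith
  have hplat : ∀ ν, |lab x ν - ctr ν| ≤ 3 / 4 * Mc := fun ν => by have := hall ν; linarith
  rcases hcase with h | ⟨μ, h | h⟩
  · exact h (chiS_eq_one ctr hMc hplat)
  · obtain ⟨-, hlab⟩ := shift_near ctr hfit hlo hhi hr hn μ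
    apply h
    apply chiS_eq_one ctr hMc
    intro ν
    show |lab (x.shift μ) ν - ctr ν| ≤ 3 / 4 * Mc
    rw [hlab]
    by_cases hν : ν = μ
    · subst hν
      rw [Function.update_self]
      have := hall ν
      calc |lab x ν + 1 - ctr ν| = |(lab x ν - ctr ν) + 1| := by ring_nf
        _ ≤ |lab x ν - ctr ν| + |(1 : ℝ)| := abs_add_le _ _
        _ ≤ 3 / 4 * Mc := by rw [abs_one]; linarith
    · rw [Function.update_of_ne hν]; exact hplat ν
  · obtain ⟨-, hlab⟩ := unshift_near ctr hx₀ hlo hhi hr hn μ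
    apply h
    apply chiS_eq_one ctr hMc
    intro ν
    show |lab (x.unshift μ) ν - ctr ν| ≤ 3 / 4 * Mc
    rw [hlab]
    by_cases hν : ν = μ
    · subst hν
      rw [Function.update_self]
      have := hall ν
      calc |lab x ν - 1 - ctr ν| = |(lab x ν - ctr ν) + (-1)| := by ring_nf
        _ ≤ |lab x ν - ctr ν| + |(-1 : ℝ)| := abs_add_le _ _
        _ ≤ 3 / 4 * Mc := by rw [abs_neg, abs_one]; linarith
    · rw [Function.update_of_ne hν]; exact hplat ν

end ZoneFar

end

end Literature.MathematicalPhysics.QuantumFieldTheory.Balaban1983to89.B6Line3CutoffV1L0
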